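import Literature.Geometry.Lorentzian.KerrConvergence
import Literature.Geometry.Lorentzian.SchwarzschildKerrSchildComponents
import HarnessLib

/-!
# Route ClusterCompleteness · crux `OmegaLimitMultiKerr` — the exact `C⁰` cost of rebasing the
# anchor label between two Schwarzschild references at rest

Structure lemmas for the crux stmt-FinalStateConjecture-14664
(`ClusterCompleteness.OmegaLimitMultiKerr`), line `Sketch`, registered stub
`norm_kerr_bilin_sub_kerr_bilin_of_spin_zero` (closed form).

The recur-disjunct of the crux carries an ALL-TIME `C⁰` ANCHOR: on every certified slab the hole
chart metric `Ψ^* 𝐠(x)` stays within operator-norm distance `1/4` (Euclidean coordinates of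
`E4`) of the reference Kerr–Schild field `g_{M,a,Λ,c}(x)` (route ClusterCompleteness, rev 16).
"Select-and-rebase" changes the reference label `(M, a) → (M', a')` after the fact; by the triangle
inequality the anchor transfers only up to the cost `‖g_{M,a}(x) − g_{M',a'}(x)‖`. This file
computes that cost EXACTLY for Schwarzschild labels at rest (`a = a' = 0`, trivial motion `(1, 0)`):

* `Kerr.bilin M 0 x = η + 2H ℓ ⊗ ℓ` with `H = M / r`, `r = Kerr.radius 0 x = ‖x⃗‖`,
  `ℓ = (1, x⃗/r)` (Kerr–Schild 1965, §2; Visser arXiv:0706.0622, (32)–(35) at `a = 0`), so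
  `g_M(x) − g_{M'}(x) = (2(M − M')/r) ℓ ⊗ ℓ` (`kerr_bilin_sub_kerr_bilin` and the landed
  `Kerr.scalarH_zero_spin` of `SchwarzschildKerrSchildComponents`);
* the operator norm of a rank-one form is `‖α ⊗ β‖ = ‖α‖‖β‖`
  (`ContinuousLinearMap.norm_smulRight_apply`) and the operator norm of a covector on the Euclidean
  `E4` is the Euclidean norm of its components (Riesz: `E4.covector c = ⟪c, ·⟫`,
  `norm_covector_sq`), whence `‖ℓ‖² = 1 + ‖x⃗‖²/r² = 2` (`nullCovectorFun_spin_zero`,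
  `norm_nullCovector_zero_sq`) and `‖ℓ ⊗ ℓ‖ = 2` (`norm_tmul_nullCovector_zero`);
* `norm_kerr_bilin_sub_kerr_bilin_of_spin_zero` (MAIN, registered):
  `‖g_M(x) − g_{M'}(x)‖ = 4|M − M'| / r` wherever `r > 0`; the same in the crux's boosted
  vocabulary with the trivial motion (`norm_boostedKerrBilin_one_zero_sub_of_spin_zero`);
* riders: at a point of the reference horizon `r = 2M` the cost is `2|M − M'| / M`
  (`norm_kerr_bilin_sub_kerr_bilin_at_horizon`), and it exceeds the anchor radius `1/4` iff
  `|M − M'| > M/8` (`quarter_lt_two_mul_abs_sub_div_iff`,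
  `quarter_lt_norm_kerr_bilin_sub_at_horizon_iff`): a `1/4`-anchor at the horizon cannot be
  rebased for free to a label differing by more than `12.5%` in mass.

Everything is proved; Mathlib + landed `Literature` files only, no definitions.

## References
* R. P. Kerr, A. Schild, *A new class of vacuum solutions of the Einstein field equations*, 1965,
  §2 (`g = η + 2Hℓ ⊗ ℓ`). [KerrSchild1965]
* M. Visser, *The Kerr spacetime: a brief introduction*, arXiv:0706.0622, §5, (32)–(35).
  [arXiv07060622]
-/

-- every `Summit.FinalStateConjecture.FinalStateConjecture.…` name repeats the summit = sub-problem segment (D-0017 layout)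
set_option linter.dupNamespace false
-- the normed-group instances on `E →L[ℝ] E →L[ℝ] ℝ` need one more level of pending instance
-- problems than the default (as in `CoordCurvature.lean`, `…OmegaLimitMultiKerrRestAnchor.lean`)
set_option maxSynthPendingDepth 3

noncomputable section

namespace Summit.FinalStateConjecture.FinalStateConjecture.Theorems.ClusterCompleteness

open Literature.Geometry.Lorentzian

/-! ### Operator norms of covectors and rank-one forms on the Euclidean `E4` -/

/-- Riesz representation in coordinates: the covector `∑ μ, c μ dx^μ` is `⟪c, ·⟫` for the
Euclidean inner product of `E4` (Visser arXiv:0706.0622, (34) for the components). [folklore] -/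
theorem covector_eq_innerSL (c : Fin 4 → ℝ) :
    E4.covector c = innerSL ℝ (WithLp.toLp 2 c : E4) := by
  ext v
  simp [E4.covector_apply, PiLp.inner_apply, mul_comm]

/-- The operator norm of a covector on the Euclidean `E4` is the Euclidean norm of its component
vector (`innerSL` is an isometry). [folklore] -/
theorem norm_covector (c : Fin 4 → ℝ) : ‖E4.covector c‖ = ‖(WithLp.toLp 2 c : E4)‖ := by
  rw [covector_eq_innerSL, innerSL_apply_norm]

/-- `‖∑ μ, c μ dx^μ‖² = ∑ μ, (c μ)²` on the Euclidean `E4`. [folklore] -/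
theorem norm_covector_sq (c : Fin 4 → ℝ) : ‖E4.covector c‖ ^ 2 = ∑ μ, c μ ^ 2 := by
  rw [norm_covector, EuclideanSpace.real_norm_sq_eq]

/-- The operator norm of a rank-one form is multiplicative: `‖α ⊗ β‖ = ‖α‖‖β‖`
(Mathlib's `ContinuousLinearMap.norm_smulRight_apply`; Kerr–Schild 1965, the rank-one term
`ℓ ⊗ ℓ`). [folklore] -/
theorem opNorm_tmul (α β : E4 →L[ℝ] ℝ) : ‖E4.tmul α β‖ = ‖α‖ * ‖β‖ :=
  ContinuousLinearMap.norm_smulRight_apply α β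

/-! ### The Schwarzschild (`a = 0`) Kerr–Schild quantities -/

/-- For `a = 0` and `r = Kerr.radius 0 x > 0`, the Kerr–Schild covector has components
`ℓ = (1, x₁/r, x₂/r, x₃/r) = (1, x⃗/r)` (Visser arXiv:0706.0622, (34) at `a = 0`).
[cite: arXiv07060622, (34)] -/
theorem nullCovectorFun_spin_zero {x : E4} (hx : 0 < Kerr.radius 0 x) :
    Kerr.nullCovectorFun 0 x =
      ![1, x 1 / Kerr.radius 0 x, x 2 / Kerr.radius 0 x, x 3 / Kerr.radius 0 x] := by
  have hr : Kerr.radius 0 x ≠ 0 := hx.ne'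
  simp only [Kerr.nullCovectorFun, zero_mul, add_zero, sub_zero, sq, mul_div_mul_left _ _ hr]

/-- For `a = 0` and `r > 0`, the components `ℓ = (1, x⃗/r)` of the Kerr–Schild covector have
Euclidean square norm `1 + ‖x⃗‖²/r² = 2` (Visser arXiv:0706.0622, (34)–(35) at `a = 0`, where
`r = ‖x⃗‖`, `Kerr.radius_zero_left`). [cite: arXiv07060622, (34)] -/
theorem sum_sq_nullCovectorFun_zero {x : E4} (hx : 0 < Kerr.radius 0 x) :
    ∑ μ, Kerr.nullCovectorFun 0 x μ ^ 2 = 2 := by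
  have hr : Kerr.radius 0 x ≠ 0 := hx.ne'
  have hsq : x 1 ^ 2 + x 2 ^ 2 + x 3 ^ 2 = Kerr.radius 0 x ^ 2 := by
    rw [Kerr.radius_zero_left, E4.spatialNorm_sq]
  rw [nullCovectorFun_spin_zero hx]
  simp only [Fin.sum_univ_four, Fin.isValue, Matrix.cons_val_zero, Matrix.cons_val_one,
    Matrix.cons_val]
  field_simp
  linear_combination hsq

/-- `‖ℓ‖² = 2` for the Schwarzschild Kerr–Schild covector `ℓ = (1, x⃗/r)` in the Euclidean
operator norm of `E4`, wherever `r > 0`. [cite: arXiv07060622, (34)] -/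
theorem norm_nullCovector_zero_sq {x : E4} (hx : 0 < Kerr.radius 0 x) :
    ‖Kerr.nullCovector 0 x‖ ^ 2 = 2 := by
  rw [Kerr.nullCovector, norm_covector_sq, sum_sq_nullCovectorFun_zero hx]

/-- `‖ℓ‖ = √2` for the Schwarzschild Kerr–Schild covector, wherever `r > 0`.
[cite: arXiv07060622, (34)] -/
theorem norm_nullCovector_zero {x : E4} (hx : 0 < Kerr.radius 0 x) :
    ‖Kerr.nullCovector 0 x‖ = √2 := by
  rw [← norm_nullCovector_zero_sq hx, Real.sqrt_sq (norm_nonneg _)]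

/-- `‖ℓ ⊗ ℓ‖ = ‖ℓ‖² = 2` for the Schwarzschild rank-one term, wherever `r > 0`
(Kerr–Schild 1965, §2). [cite: KerrSchild1965, §2] -/
theorem norm_tmul_nullCovector_zero {x : E4} (hx : 0 < Kerr.radius 0 x) :
    ‖E4.tmul (Kerr.nullCovector 0 x) (Kerr.nullCovector 0 x)‖ = 2 := by
  rw [opNorm_tmul, ← sq, norm_nullCovector_zero_sq hx]

/-! ### The rebase cost -/

/-- Two Kerr–Schild forms with the same spin at the same point differ by a multiple of the common
rank-one term: `g_{M,a}(x) − g_{M',a}(x) = (2H_M − 2H_{M'}) ℓ ⊗ ℓ` (Kerr–Schild 1965, §2: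
`g = η + 2Hℓ ⊗ ℓ`, `H` linear in `M`, `ℓ` independent of `M`). [cite: KerrSchild1965, §2] -/
theorem kerr_bilin_sub_kerr_bilin (M M' a : ℝ) (x : E4) :
    Kerr.bilin M a x - Kerr.bilin M' a x =
      (2 * Kerr.scalarH M a x - 2 * Kerr.scalarH M' a x) •
        E4.tmul (Kerr.nullCovector a x) (Kerr.nullCovector a x) := by
  rw [Kerr.bilin, Kerr.bilin, add_sub_add_left_eq_sub, sub_smul]

/-- **The exact `C⁰` rebase cost between Schwarzschild references at rest** (registered stub):
wherever `r = Kerr.radius 0 x > 0`,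
`‖g_M(x) − g_{M'}(x)‖ = ‖(2(M − M')/r) ℓ ⊗ ℓ‖ = (2|M − M'|/r) · ‖ℓ‖² = 4|M − M'| / r`
in the Euclidean operator norm of `E4` (Kerr–Schild 1965, §2; Visser arXiv:0706.0622, (32)–(35)
at `a = 0`). [cite: KerrSchild1965, §2] -/
theorem norm_kerr_bilin_sub_kerr_bilin_of_spin_zero :
    ∀ (M M' : ℝ) {x : E4}, 0 < Kerr.radius 0 x →
      ‖Kerr.bilin M 0 x - Kerr.bilin M' 0 x‖ = 4 * |M - M'| / Kerr.radius 0 x := by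
  intro M M' x hx
  -- `H = M / r` at `a = 0` is the landed `Kerr.scalarH_zero_spin` (stated with `r = ‖x⃗‖`)
  have hr : Kerr.radius 0 x = E4.spatialNorm x := Kerr.radius_zero_left x
  have hs : E4.spatialNorm x ≠ 0 := hr ▸ hx.ne'
  rw [kerr_bilin_sub_kerr_bilin, norm_smul, norm_tmul_nullCovector_zero hx,
    Kerr.scalarH_zero_spin M hs, Kerr.scalarH_zero_spin M' hs, ← hr, Real.norm_eq_abs,
    show 2 * (M / Kerr.radius 0 x) - 2 * (M' / Kerr.radius 0 x) = 2 / Kerr.radius 0 x * (M - M') by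
      ring,
    abs_mul, abs_of_pos (by positivity : (0 : ℝ) < 2 / Kerr.radius 0 x)]
  ring

/-- The same cost in the crux's boosted vocabulary with the trivial motion `(1, 0)`
(`boostedKerrBilin_one_zero`): `‖g_{M,0,1,0}(x) − g_{M',0,1,0}(x)‖ = 4|M − M'| / r`.
[cite: KerrSchild1965, §2] -/
theorem norm_boostedKerrBilin_one_zero_sub_of_spin_zero (M M' : ℝ) {x : E4}
    (hx : 0 < Kerr.radius 0 x) :
    ‖boostedKerrBilin 1 0 M 0 x - boostedKerrBilin 1 0 M' 0 x‖ =
      4 * |M - M'| / Kerr.radius 0 x := by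
  rw [boostedKerrBilin_one_zero, boostedKerrBilin_one_zero]
  exact norm_kerr_bilin_sub_kerr_bilin_of_spin_zero M M' hx

/-! ### Riders: the cost at the reference horizon and the `1/4` threshold -/

/-- At a point of the reference Schwarzschild horizon `r = 2M` (`0 < M`) the rebase cost is
`4|M − M'|/(2M) = 2|M − M'| / M`. [cite: KerrSchild1965, §2] -/
theorem norm_kerr_bilin_sub_kerr_bilin_at_horizon {M : ℝ} (M' : ℝ) {x : E4} (hM : 0 < M)
    (hx : Kerr.radius 0 x = 2 * M) :
    ‖Kerr.bilin M 0 x - Kerr.bilin M' 0 x‖ = 2 * |M - M'| / M := by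
  rw [norm_kerr_bilin_sub_kerr_bilin_of_spin_zero M M' (by rw [hx]; positivity), hx]
  field_simp
  ring

/-- The threshold reading on reals: for `0 < M`, `2|M − M'|/M > 1/4 ↔ |M − M'| > M/8`. [folklore] -/
theorem quarter_lt_two_mul_abs_sub_div_iff {M : ℝ} (M' : ℝ) (hM : 0 < M) :
    1 / 4 < 2 * |M - M'| / M ↔ M / 8 < |M - M'| := by
  rw [lt_div_iff₀ hM]
  constructor <;> intro h <;> linarith

/-- Hence at the reference horizon the rebase cost exceeds the crux's anchor radius `1/4` iff the
labels differ by more than `M/8` in mass: a `1/4`-anchor does not transfer for free between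
Schwarzschild labels `12.5%` apart. [folklore] -/
theorem quarter_lt_norm_kerr_bilin_sub_at_horizon_iff {M : ℝ} (M' : ℝ) {x : E4} (hM : 0 < M)
    (hx : Kerr.radius 0 x = 2 * M) :
    1 / 4 < ‖Kerr.bilin M 0 x - Kerr.bilin M' 0 x‖ ↔ M / 8 < |M - M'| := by
  rw [norm_kerr_bilin_sub_kerr_bilin_at_horizon M' hM hx, quarter_lt_two_mul_abs_sub_div_iff M' hM]

end Summit.FinalStateConjecture.FinalStateConjecture.Theorems.ClusterCompleteness

end
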